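import Summits.KontsevichZagierPeriods.KontsevichZagierPeriods.Theorems.LinRedNormalFormHoffmanSpanInKZModVec
import Summits.KontsevichZagierPeriods.KontsevichZagierPeriods.Theorems.LinRedNormalFormHoffmanSpanInKZCover
import Mathlib.Algebra.BigOperators.Pi
import Mathlib.Algebra.Module.Equiv.Basic

/-!
# Crux `LinRedNormalForm.HoffmanSpanInKZ` (stmt-KontsevichZagierPeriods-15044), line `Sketch`:
# elimination transcripts checked MODULO A PRIME — the checkers (registered stub `stub_modTables`)

The two-table transcript format of `LinRedNormalFormHoffmanSpanInKZDerived` (derived rows citing earlier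
rows, word rows citing derived rows and earlier words), with all coefficients in `ZMod p` and the merge
accumulator of `LinRedNormalFormHoffmanSpanInKZModVec`:

* `DRowP` / `dtableOkP`: row `i` names a generator `g` (checked: side conditions `g.ok`, and `admOk` — every
  word of its integer expansion is admissible), cites earlier rows with coefficients mod `p`, and claims its
  reduced vector mod `p`; soundness (`mem_spanP_of_dtableOkP`): every claimed vector realises INSIDE
  `spanP p N`, the `ZMod p`-span of the reductions of the integer generator vectors and of the Hoffman unit
  vectors (`GZ N`);
* `WRowP` / `wtableOkP`: the row of a word (as a code) cites earlier-certified words (codes), Hoffman words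
  (indices, checked Hoffman of weight `N` with admissible word) and derived vectors; soundness
  (`single_mem_spanP_of_wtableOkP`): the unit vector of every word of the table lies in `spanP p N`;
* the assembly into `EdsCertificate N` is `LinRedNormalFormHoffmanSpanInKZModCert`.

Sources: the reflection set-up of the Derived files (this tree); rank inequality under reduction mod `p`
(`LinRedNormalFormHoffmanSpanInKZModBridge`). [folklore]
-/

namespace Summit.KontsevichZagierPeriods.LinRedNormalForm.HoffmanSpanInKZ

open Literature.NumberTheory.Transcendental
open Summit.KontsevichZagierPeriods.MzvKernelInKZ.Negative
open Summit.KontsevichZagierPeriods.MzvKernelInKZ.TwoPosets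
open Submodule

/-! ## The generating family and its span modulo `p` -/

/-- The integer generating family of weight `N`: integer vectors of checked generators (side conditions and
admissible support) and the unit vectors of the Hoffman words of weight `N` (with admissible word). [folklore] -/
def GZ (N : ℕ) : Set ((Fin N → Bool) → ℤ) :=
  {v | ∃ g : Gen, g.ok N = true ∧ admOk N (g.fvecZ N) = true ∧ v = g.vecZ N} ∪
  {v | ∃ h : List ℕ, MZV.IsHoffman h ∧ MZV.weight h = N ∧ Adm (bword N h) ∧ v = Pi.single (bword N h) 1}

/-- The span modulo `p` of the reductions of the generating family. [folklore] -/
def spanP (p N : ℕ) : Submodule (ZMod p) ((Fin N → Bool) → ZMod p) := span (ZMod p) (redP p '' GZ N)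

/-- Reduction of an integer unit vector. [folklore] -/
theorem redP_single {N : ℕ} (p : ℕ) (ε : Fin N → Bool) :
    redP p (Pi.single ε (1 : ℤ)) = (Pi.single ε (1 : ZMod p) : (Fin N → Bool) → ZMod p) := by
  funext x
  simp [redP, Pi.single_apply]

/-- Rational image of an integer unit vector. [folklore] -/
theorem toQ_single {N : ℕ} (ε : Fin N → Bool) : toQ (Pi.single ε (1 : ℤ)) = unitVec N ε := by
  funext x
  simp [toQ, unitVec, Pi.single_apply]

/-- A checked generator realises (mod `p`) inside `spanP`. [folklore] -/
theorem evalG_fvecP_mem_spanP {p N : ℕ} (g : Gen) (hg : g.ok N = true) (ha : admOk N (g.fvecZ N) = true) :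
    evalG (ZMod p) N (g.fvecP p N) ∈ spanP p N := by
  rw [← redP_vecZ]
  exact subset_span ⟨g.vecZ N, Or.inl ⟨g, hg, ha, rfl⟩, rfl⟩

/-- A Hoffman unit vector (mod `p`) lies in `spanP`. [folklore] -/
theorem single_bword_mem_spanP {p N : ℕ} (h : List ℕ) (hh : MZV.IsHoffman h) (hw : MZV.weight h = N)
    (ha : Adm (bword N h)) : (Pi.single (bword N h) (1 : ZMod p) : (Fin N → Bool) → ZMod p) ∈ spanP p N := by
  rw [← redP_single]
  exact subset_span ⟨_, Or.inr ⟨h, hh, hw, ha, rfl⟩, rfl⟩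

/-! ## Derived rows modulo `p` -/

/-- A derived row mod `p`: generator, citations `(earlier row, coefficient)`, claimed vector
`(word code, coefficient)`, coefficients as naturals `< p`. [folklore] -/
structure DRowP where
  /-- the generator entering this row -/
  g : Gen
  /-- earlier derived rows, by index, with coefficients mod `p` -/
  L : List (ℕ × ℕ)
  /-- the claimed vector: word codes with coefficients mod `p` (codes increasing) -/
  V : List (ℕ × ℕ)

/-- The claimed vector of a row as a mod-`p` combination. [folklore] -/
def DRowP.vvec (p N : ℕ) (d : DRowP) : List (List Bool × ZMod p) :=
  d.V.map fun q => (wordOfCode N q.1, ((q.2 : ℕ) : ZMod p))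

/-- The accumulator of a row: `−V`, generator terms inserted, citations merged. [folklore] -/
def DRowP.acc (p N : ℕ) (mem : List (List (List Bool × ZMod p))) (d : DRowP) : List (List Bool × ZMod p) :=
  d.L.foldl (fun a q => mergeP ((q.2 : ℕ) : ZMod p) (mem.getD q.1 []) a)
    ((d.g.fvecP p N).foldl (fun a q => insP q.1 q.2 a) (smulP (-1) (d.vvec p N)))

/-- Derived-row checker mod `p`. [folklore] -/
def drowOkP (p N : ℕ) (mem : List (List (List Bool × ZMod p))) (d : DRowP) : Bool :=
  d.g.ok N && admOk N (d.g.fvecZ N) && (d.acc p N mem).isEmpty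

/-- Derived-table checker mod `p`, threading the claimed vectors. [folklore] -/
def dtableOkP (p N : ℕ) : List (List (List Bool × ZMod p)) → List DRowP → Bool
  | _, [] => true
  | mem, d :: ds => drowOkP p N mem d && dtableOkP p N (mem ++ [d.vvec p N]) ds

section DSound

variable {p N : ℕ}

/-- An empty accumulator realises to `0`. [folklore] -/
theorem evalG_eq_zero_of_isEmpty {v : List (List Bool × ZMod p)} (h : v.isEmpty = true) :
    evalG (ZMod p) N v = 0 := by
  rw [List.isEmpty_iff] at h
  subst h
  rfl

/-- Memory vectors in `spanP` give cited combinations in `spanP`. [folklore] -/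
theorem sum_cites_mem_spanP (mem : List (List (List Bool × ZMod p)))
    (hmem : ∀ v ∈ mem, evalG (ZMod p) N v ∈ spanP p N) (f : ℕ → ZMod p) (L : List (ℕ × ℕ)) :
    (L.map fun q => f q.2 • evalG (ZMod p) N (mem.getD q.1 [])).sum ∈ spanP p N := by
  refine list_sum_mem fun x hx => ?_
  obtain ⟨q, _, rfl⟩ := List.mem_map.1 hx
  refine smul_mem _ _ ?_
  rw [List.getD_eq_getElem?_getD]
  cases hk : mem[q.1]? with
  | none => simp
  | some v => exact hmem v (List.mem_of_getElem? hk)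

/-- **Soundness of one derived row mod `p`.** [folklore] -/
theorem mem_spanP_of_drowOkP (mem : List (List (List Bool × ZMod p)))
    (hmem : ∀ v ∈ mem, evalG (ZMod p) N v ∈ spanP p N) (d : DRowP) (h : drowOkP p N mem d = true) :
    evalG (ZMod p) N (d.vvec p N) ∈ spanP p N := by
  simp only [drowOkP, Bool.and_eq_true] at h
  obtain ⟨⟨hg, ha⟩, hz⟩ := h
  have h0 := evalG_eq_zero_of_isEmpty (N := N) hz
  rw [DRowP.acc, evalG_foldl_mergeP, evalG_foldl_insP, evalG_smulP, neg_one_smul] at h0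
  have h1 : evalG (ZMod p) N (d.vvec p N) =
      (d.L.map fun q => ((q.2 : ℕ) : ZMod p) • evalG (ZMod p) N (mem.getD q.1 [])).sum +
        evalG (ZMod p) N (d.g.fvecP p N) := by
    rw [← sub_eq_zero, ← neg_eq_zero, ← h0]; abel
  rw [h1]
  exact add_mem (sum_cites_mem_spanP mem hmem _ d.L) (evalG_fvecP_mem_spanP d.g hg ha)

/-- **Soundness of the derived-table checker mod `p`.** [folklore] -/
theorem mem_spanP_of_dtableOkP :
    ∀ (T : List DRowP) (mem : List (List (List Bool × ZMod p))),
      (∀ v ∈ mem, evalG (ZMod p) N v ∈ spanP p N) → dtableOkP p N mem T = true →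
        ∀ v ∈ mem ++ T.map (DRowP.vvec p N), evalG (ZMod p) N v ∈ spanP p N := by
  intro T
  induction T with
  | nil => intro mem hmem _ v hv; simpa using hmem v (by simpa using hv)
  | cons d T ih =>
    intro mem hmem h v hv
    simp only [dtableOkP, Bool.and_eq_true] at h
    obtain ⟨hd, hT⟩ := h
    have hdv := mem_spanP_of_drowOkP mem hmem d hd
    have hmem' : ∀ v ∈ mem ++ [d.vvec p N], evalG (ZMod p) N v ∈ spanP p N := by
      intro v hv
      rcases List.mem_append.1 hv with h' | h'
      · exact hmem v h'
      · simp only [List.mem_singleton] at h'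
        subst h'
        exact hdv
    refine ih (mem ++ [d.vvec p N]) hmem' hT v ?_
    simpa [List.append_assoc] using hv

/-- Splitting a derived-table check at an append. [folklore] -/
theorem dtableOkP_append :
    ∀ (A B : List DRowP) (mem : List (List (List Bool × ZMod p))), dtableOkP p N mem A = true →
      dtableOkP p N (mem ++ A.map (DRowP.vvec p N)) B = true → dtableOkP p N mem (A ++ B) = true := by
  intro A
  induction A with
  | nil => intro B mem _ h; simpa using h
  | cons d A ih =>
    intro B mem h₁ h₂
    simp only [dtableOkP, List.cons_append, Bool.and_eq_true] at h₁ ⊢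
    refine ⟨h₁.1, ih B (mem ++ [d.vvec p N]) h₁.2 ?_⟩
    simpa [List.append_assoc] using h₂

end DSound

/-! ## Word rows modulo `p` -/

/-- A word row mod `p`: the word (code), cited earlier words (codes), Hoffman indices, cited derived rows,
with coefficients mod `p`. [folklore] -/
structure WRowP where
  /-- the word, as a code -/
  w : ℕ
  /-- cited words (codes), certified earlier, with coefficients -/
  P : List (ℕ × ℕ)
  /-- Hoffman indices of weight `N` with coefficients -/
  H : List (List ℕ × ℕ)
  /-- cited derived rows, by index, with coefficients -/
  E : List (ℕ × ℕ)

/-- The accumulator of a word row. [folklore] -/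
def WRowP.acc (p N : ℕ) (dv : List (List (List Bool × ZMod p))) (c : WRowP) : List (List Bool × ZMod p) :=
  c.E.foldl (fun a q => mergeP (-((q.2 : ℕ) : ZMod p)) (dv.getD q.1 []) a)
    (((c.P.map fun q => (wordOfCode N q.1, -((q.2 : ℕ) : ZMod p))) ++
        (c.H.map fun q => (MZV.binaryWord q.1, -((q.2 : ℕ) : ZMod p)))).foldl
      (fun a q => insP q.1 q.2 a) [(wordOfCode N c.w, 1)])

/-- Word-row checker mod `p`. [folklore] -/
def wrowOkP (p N : ℕ) (dv : List (List (List Bool × ZMod p))) (prev : List ℕ) (c : WRowP) : Bool :=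
  decide (∀ q ∈ c.H, MZV.IsHoffman q.1 ∧ MZV.weight q.1 = N ∧ Adm (bword N q.1)) &&
  c.P.all (fun q => prev.contains q.1) && (c.acc p N dv).isEmpty

/-- Word-table checker mod `p`, threading the codes certified so far. [folklore] -/
def wtableOkP (p N : ℕ) (dv : List (List (List Bool × ZMod p))) : List ℕ → List WRowP → Bool
  | _, [] => true
  | prev, c :: T => wrowOkP p N dv prev c && wtableOkP p N dv (c.w :: prev) T

/-- The unit vector (mod `p`) of the word with code `c`. [folklore] -/
def uP (p N c : ℕ) : (Fin N → Bool) → ZMod p := Pi.single (wordOf N (wordOfCode N c)) 1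

section WSound

variable {p N : ℕ}

/-- Realisation of a list of negated unit-vector terms. [folklore] -/
theorem evalG_map_neg (l : List (List Bool × ZMod p)) :
    evalG (ZMod p) N (l.map fun q => (q.1, -q.2)) = -evalG (ZMod p) N l := by
  induction l with
  | nil => simp
  | cons q l ih => rw [List.map_cons, evalG_cons, evalG_cons, ih, neg_smul, neg_add]

/-- **Soundness of one word row mod `p`.** [folklore] -/
theorem uP_mem_spanP_of_wrowOkP (dv : List (List (List Bool × ZMod p)))
    (hdv : ∀ v ∈ dv, evalG (ZMod p) N v ∈ spanP p N) (prev : List ℕ) (hprev : ∀ c ∈ prev, uP p N c ∈ spanP p N)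
    (c : WRowP) (h : wrowOkP p N dv prev c = true) : uP p N c.w ∈ spanP p N := by
  simp only [wrowOkP, Bool.and_eq_true, decide_eq_true_eq, List.all_eq_true] at h
  obtain ⟨⟨hH, hP⟩, hz⟩ := h
  have h0 := evalG_eq_zero_of_isEmpty (N := N) hz
  rw [WRowP.acc, evalG_foldl_mergeP dv (fun n : ℕ => -((n : ℕ) : ZMod p)), evalG_foldl_insP, evalG_append,
    evalG_cons, evalG_nil] at h0
  -- the two inserted lists are negations of positive lists
  set LP : List (List Bool × ZMod p) := c.P.map fun q => (wordOfCode N q.1, ((q.2 : ℕ) : ZMod p)) with hLP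
  set LH : List (List Bool × ZMod p) := c.H.map fun q => (MZV.binaryWord q.1, ((q.2 : ℕ) : ZMod p)) with hLH
  have eP : (c.P.map fun q => (wordOfCode N q.1, -((q.2 : ℕ) : ZMod p))) = LP.map fun q => (q.1, -q.2) := by
    simp [hLP, List.map_map, Function.comp_def]
  have eH : (c.H.map fun q => (MZV.binaryWord q.1, -((q.2 : ℕ) : ZMod p))) = LH.map fun q => (q.1, -q.2) := by
    simp [hLH, List.map_map, Function.comp_def]
  have eE : ∀ E : List (ℕ × ℕ),
      (E.map fun q => -((q.2 : ℕ) : ZMod p) • evalG (ZMod p) N (dv.getD q.1 [])).sum =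
        -(E.map fun q => ((q.2 : ℕ) : ZMod p) • evalG (ZMod p) N (dv.getD q.1 [])).sum := by
    intro E
    induction E with
    | nil => simp
    | cons q E ih =>
      rw [List.map_cons, List.map_cons, List.sum_cons, List.sum_cons, ih, neg_smul, neg_add]
  rw [eP, eH, evalG_map_neg, evalG_map_neg, eE c.E, one_smul, add_zero] at h0
  have h1 : uP p N c.w = (c.E.map fun q => ((q.2 : ℕ) : ZMod p) • evalG (ZMod p) N (dv.getD q.1 [])).sum +
      (evalG (ZMod p) N LP + evalG (ZMod p) N LH) := by
    rw [← sub_eq_zero, ← h0, uP]; abel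
  rw [h1]
  refine add_mem (sum_cites_mem_spanP dv hdv _ c.E) (add_mem ?_ ?_)
  · rw [hLP, evalG]
    simp only [List.map_map, Function.comp_def]
    refine list_sum_mem fun x hx => ?_
    obtain ⟨q, hq, rfl⟩ := List.mem_map.1 hx
    exact smul_mem _ _ (hprev q.1 (List.contains_iff_mem.1 (hP q hq)))
  · rw [hLH, evalG]
    simp only [List.map_map, Function.comp_def]
    refine list_sum_mem fun x hx => ?_
    obtain ⟨q, hq, rfl⟩ := List.mem_map.1 hx
    obtain ⟨h1, h2, h3⟩ := hH q hq
    exact smul_mem _ _ (single_bword_mem_spanP q.1 h1 h2 h3)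

/-- **Soundness of the word-table checker mod `p`.** [folklore] -/
theorem uP_mem_spanP_of_wtableOkP (dv : List (List (List Bool × ZMod p)))
    (hdv : ∀ v ∈ dv, evalG (ZMod p) N v ∈ spanP p N) :
    ∀ (T : List WRowP) (prev : List ℕ), (∀ c ∈ prev, uP p N c ∈ spanP p N) →
      wtableOkP p N dv prev T = true → ∀ c ∈ T, uP p N c.w ∈ spanP p N := by
  intro T
  induction T with
  | nil => intro _ _ _ c hc; simp at hc
  | cons c T ih =>
    intro prev hprev h c' hc'
    simp only [wtableOkP, Bool.and_eq_true] at h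
    obtain ⟨hc, hT⟩ := h
    have hcw := uP_mem_spanP_of_wrowOkP dv hdv prev hprev c hc
    rcases List.mem_cons.1 hc' with rfl | hmem
    · exact hcw
    · refine ih (c.w :: prev) ?_ hT c' hmem
      intro w hw
      rcases List.mem_cons.1 hw with rfl | hw'
      exacts [hcw, hprev w hw']

/-- Splitting a word-table check at an append. [folklore] -/
theorem wtableOkP_append (dv : List (List (List Bool × ZMod p))) :
    ∀ (T₁ T₂ : List WRowP) (prev : List ℕ),
      wtableOkP p N dv prev T₁ = true → wtableOkP p N dv ((T₁.map WRowP.w).reverse ++ prev) T₂ = true →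
        wtableOkP p N dv prev (T₁ ++ T₂) = true := by
  intro T₁
  induction T₁ with
  | nil => intro T₂ prev _ h; simpa using h
  | cons c T₁ ih =>
    intro T₂ prev h₁ h₂
    simp only [wtableOkP, List.cons_append, Bool.and_eq_true] at h₁ ⊢
    refine ⟨h₁.1, ih T₂ (c.w :: prev) h₁.2 ?_⟩
    simpa [List.map_cons, List.reverse_cons, List.append_assoc] using h₂

end WSound

/-! ## The registered stub -/

/-- Soundness of the mod-`p` checkers into `spanP`, as one statement about this file's checkers (not a
published fact). -/
def ModTablesSound : Prop :=
  (∀ (p N : ℕ) (T : List DRowP) (mem : List (List (List Bool × ZMod p))),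
      (∀ v ∈ mem, evalG (ZMod p) N v ∈ spanP p N) → dtableOkP p N mem T = true →
        ∀ v ∈ mem ++ T.map (DRowP.vvec p N), evalG (ZMod p) N v ∈ spanP p N) ∧
  (∀ (p N : ℕ) (dv : List (List (List Bool × ZMod p))), (∀ v ∈ dv, evalG (ZMod p) N v ∈ spanP p N) →
      ∀ (T : List WRowP) (prev : List ℕ), (∀ c ∈ prev, uP p N c ∈ spanP p N) →
        wtableOkP p N dv prev T = true → ∀ c ∈ T, uP p N c.w ∈ spanP p N)

/-- **Registered stub `stub_modTables`** of the skeleton of line `Sketch`. -/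
theorem stub_modTables : ModTablesSound :=
  ⟨fun _ _ => mem_spanP_of_dtableOkP, fun _ _ dv hdv => uP_mem_spanP_of_wtableOkP dv hdv⟩

end Summit.KontsevichZagierPeriods.LinRedNormalForm.HoffmanSpanInKZ
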